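import Literature.IUT.LogThetaLattice.PacketLogVolumesHaarModelCapsulesGeneral
import HarnessLib

/-!
# [IUTchIII] Proposition 3.9 (i) for CAPSULES at the genuine model: the archimedean packet-normalisation «multiplication
# by `e` corresponds to adding `log(e) = 1`» for REAL scalars, at the `A`-packets (proof-only)

S. Mochizuki, *Inter-universal Teichmüller theory III*, kurims manuscript (May 2020), Prop. 3.9 (i), p. 116 [claim:
Mochizuki2012, status: disputed]: at an archimedean `v_ℚ`, "we assume that these log-volumes are normalized so that
multiplication of an element of "`𝕄(−)`" by `e = 2.71828...` corresponds to adding the quantity `1 = log(e) ∈ ℝ`".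

abc-iut-L6-d3's `PacketLogVolumesHaarModelCapsulesGeneral.lean` (p419250) proves the normalisations of the `A`-packet
log-volume `capsulePacketLogVolume` for scalars that are NUMBER-FIELD elements acting on one label (`×p ↦ −log p`,
`×n ↦ +log n` at `∞`). THIS proof-only file adds the literal archimedean clause for an arbitrary REAL scalar `c ≠ 0`
(e.g. `c = e`), acting on every portion `⊗_{α,ℝ}ℂ` of the packet at `∞` by the `ℝ`-vector-space structure (the
tensor product is over `ℚ_{v_ℚ} = ℝ`, so `c` in any one factor is the scalar `c`): admissibility is preserved
(Lebesgue measure scales by `|c|^{dim}`, Mathlib `Measure.addHaar_smul`), each portion log-volume moves by `log|c|`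
(abc-iut-L5-t7 `packetLogVol_smul`), and — the portion weights summing to `1` (`sum_portionWeight`) —
**`capsulePacketLogVolume_infty_real_smul : μ^log_{A,∞}(c·T) = μ^log_{A,∞}(T) + log|c|`**, in particular
**`capsulePacketLogVolume_infty_exp_smul : μ^log_{A,∞}(e·T) = μ^log_{A,∞}(T) + 1`** for every finite label set `A` and
every region `T`. No new definition; classical; nothing here bears on [IUTchIII] Cor. 3.12 or takes a side; typed ≠
endorsed.
-/

noncomputable section

namespace Literature.IUT.LogThetaLattice

open Literature.IUT.LogVolume Literature.IUT.LogVolume.Prop15iii Literature.IUT.LogVolume.ArchPacket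
  NumberField MeasureTheory Set
open scoped ENNReal NNReal Pointwise

variable (F : Type) [Field F] [NumberField F]
variable (A : Type) [Fintype A] [DecidableEq A] [Nonempty A]

omit [NumberField F] in
/-- **Real scaling preserves admissibility of a region of the archimedean portion `⊗_{α,ℝ}ℂ`** (`c ≠ 0`): in the
canonical coordinates `Φ₀(c·S) = c·Φ₀(S)` and Lebesgue measure scales by `|c|^{dim_ℝ}`.
[claim: Mochizuki2012, status: disputed] -/
theorem archPortion_isAdm_smul (wA : A → InfinitePlace F) {c : ℝ} (hc : c ≠ 0) {S : Set (MI A Unit)}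
    (hS : (archPortion F A wA).IsAdm S) : (archPortion F A wA).IsAdm (c • S) := by
  haveI : Nonempty Unit := ⟨()⟩
  change volume ((canonicalDecomposition A Unit : MI A Unit → (Idx A Unit → ℂ)) '' (c • S)) ≠ 0 ∧
    volume ((canonicalDecomposition A Unit : MI A Unit → (Idx A Unit → ℂ)) '' (c • S)) ≠ ∞
  rw [image_smul_eq, Measure.addHaar_smul, abs_pow]
  have hpow : ENNReal.ofReal (|c| ^ Module.finrank ℝ (Idx A Unit → ℂ)) ≠ 0 := by
    rw [Ne, ENNReal.ofReal_eq_zero, not_le]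
    exact pow_pos (abs_pos.mpr hc) _
  exact ⟨mul_ne_zero hpow hS.1, ENNReal.mul_ne_top ENNReal.ofReal_ne_top hS.2⟩

omit [NumberField F] in
/-- **Each archimedean portion log-volume moves by `log|c|`** under the real scalar `c ≠ 0` (abc-iut-L5-t7
`packetLogVol_smul`: radial log-volumes move by `log|c|` on each summand, averaged). [claim: Mochizuki2012, status: disputed] -/
theorem archPortion_logVol_smul (wA : A → InfinitePlace F) {c : ℝ} (hc : c ≠ 0) {S : Set (MI A Unit)}
    (hS : (archPortion F A wA).IsAdm S) :
    (archPortion F A wA).logVol (c • S) = (archPortion F A wA).logVol S + Real.log |c| := by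
  haveI : Nonempty Unit := ⟨()⟩
  change packetLogVol (canonicalDecomposition A Unit) (c • S) = packetLogVol (canonicalDecomposition A Unit) S + _
  rw [packetLogVol_smul (canonicalDecomposition A Unit) hc hS.1 hS.2, add_comm]

/-- **[IUTchIII] Prop. 3.9 (i), archimedean packet-normalisation for the `A`-packet and a REAL scalar**: multiplying
every portion `T_π ⊆ ⊗_{α,ℝ}ℂ` of a region at `∞` by `c ≠ 0` changes `μ^log_{A,∞}` by exactly `log|c|` (portion weights
sum to `1`, `sum_portionWeight`). [claim: Mochizuki2012, status: disputed] -/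
theorem capsulePacketLogVolume_infty_real_smul {c : ℝ} (hc : c ≠ 0)
    (T : Portion F A RatPlace.infty → Set (MI A Unit))
    (hT : ∀ π, (portionDatum F A RatPlace.infty π).IsAdm (T π)) :
    capsulePacketLogVolume F A RatPlace.infty
        (fun π => ⟨c • T π, archPortion_isAdm_smul F A _ hc (hT π)⟩) =
      capsulePacketLogVolume F A RatPlace.infty (fun π => ⟨T π, hT π⟩) + Real.log |c| := by
  unfold capsulePacketLogVolume
  have h : ∀ π : Portion F A RatPlace.infty,
      portionWeight F A RatPlace.infty π * (portionDatum F A RatPlace.infty π).logVol (c • T π) =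
        portionWeight F A RatPlace.infty π * (portionDatum F A RatPlace.infty π).logVol (T π) +
          portionWeight F A RatPlace.infty π * Real.log |c| := by
    intro π
    rw [← mul_add]
    exact congrArg _ (archPortion_logVol_smul F A _ hc (hT π))
  simp_rw [h]
  rw [Finset.sum_add_distrib, ← Finset.sum_mul, sum_portionWeight, one_mul]

/-- **«multiplication … by `e = 2.71828...` corresponds to adding the quantity `1 = log(e)`»** (Prop. 3.9 (i) p. 116),
for the `A`-packet at `∞` at the genuine model, every finite `A`, every region. [claim: Mochizuki2012, status: disputed] -/
theorem capsulePacketLogVolume_infty_exp_smul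
    (T : Portion F A RatPlace.infty → Set (MI A Unit))
    (hT : ∀ π, (portionDatum F A RatPlace.infty π).IsAdm (T π)) :
    capsulePacketLogVolume F A RatPlace.infty
        (fun π => ⟨Real.exp 1 • T π, archPortion_isAdm_smul F A _ (Real.exp_pos 1).ne' (hT π)⟩) =
      capsulePacketLogVolume F A RatPlace.infty (fun π => ⟨T π, hT π⟩) + 1 := by
  rw [capsulePacketLogVolume_infty_real_smul F A (Real.exp_pos 1).ne', abs_of_pos (Real.exp_pos 1), Real.log_exp]

end Literature.IUT.LogThetaLattice

end
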